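import Literature.MathematicalPhysics.QuantumFieldTheory.Balaban1983to89.B9Eq352ScalarFluct

/-!
# `Balaban1983to89.B9Eq352DivForm` — B9 pp. 400–401, (3.52)–(3.54): the fluctuation operator `V′₁(A)` in DIVERGENCE
# FORM — the undisplayed lattice Leibniz rule `∇_μ(ad_a λ) = ad_a ∇_μλ + ad_{∇_μ a} τ_μλ` (printed in the series as [B8]
# (1.86)–(1.87), `n = 1`) kernel-checked on the concrete carrier, `V′₁(A) = Σ_{b∈st(x)} ∇_b∘(i ad_{A′(b)}) + C′₁(A)`
# EXACTLY, and the (3.54)-type bound of the zeroth-order remainder `C′₁(A)` with every `O(1)` explicit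

statement-level skeleton of published theorems with citation tags; proofs where landed; nothing here is a claim about the Yang–Mills mass gap

CITATION HEADER (lean-in-tree rule).  Cell `lit-balaban` (HOME `run/shared/lean/pub/lit-balaban/`), reader/typer seat
`lit-balaban-r06` (B9 fold owner), gen 8; SKELETON rows **B9.Eq3.50 / B9.Eq3.54** (the operator `V′₁(A)`) × **B9.Eq3.68 /
B9.Eq3.85** (the commutator letters `hComm : [V¹, ∇]` of this seat's `B9Ineq368PPrimeDs` §5 / `B9Ineq386RightEntry` §5,
whose identification «on a concrete carrier (lattice Leibniz + (3.37))» the gen-7 FINAL hand-off lists as not done).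
Sources (both HELD, journal page = PDF page + offset):
* **B9** = T. Bałaban, *Propagators for lattice gauge theories in a background field*, Commun. Math. Phys. **99** (1985)
  389–434 [Balaban1985BackgroundPropagators] (`paper:balaban1985-cmp99-background-propagators`, offset 388): p. 400
  [PDF 12] (3.50)–(3.53) (render `b2b-balaban-ref1/pages/1985-cmp99-background-propagators/…-p012-x2.png` READ AS IMAGE by
  this seat, 2026-08-21), p. 401 [PDF 13] (3.54), p. 396 [PDF 8] (3.37), p. 405 [PDF 17] («The derivatives are, of course,
  the covariant derivatives defined by U»), p. 398 [PDF 10] («we may always replace ∇_U by ∇*_U»);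
* **B8** = T. Bałaban, *Spaces of regular gauge field configurations on a lattice and gauge fixing conditions*, Commun.
  Math. Phys. **99** (1985) 75–102 [Balaban1985RegularSpaces] (`paper:balaban1985-cmp99-regular-spaces-gauge-fixing`, offset
  74): p. 91 [PDF 17] (1.86)–(1.87) (render `…/1985-cmp99-regular-spaces-gauge-fixing-p017-x2.png` READ AS IMAGE by this
  seat, 2026-08-21) — the ONE place in the series where the lattice Leibniz rule for a covariant difference past `ad` is
  DISPLAYED.
This module is the divergence-form SIBLING of this seat's gen-1 `B9Eq352ScalarFluct` ((3.50)–(3.54): `siteLap`, `V1p`,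
`Fp1`, `eq353`, `V1p_eq_firstOrder`, `norm_Fp1_le`, `norm_V1p_le(_printed)` — imported and used BY NAME) on the lattice
vocabulary of `B9Eq39Adjoint` (`R W X = WXW⁻¹`, `covD`, `covDstar`, `divB`: sites `S`, directions `ι`, shifts `T μ : S ≃ S`,
bond units `U μ x = U(x, x+e_μ)`, `η`-FREE differences `D¹ = ηD`, `D¹* = ηD*`).  The two ring identities it rests on —
«R(V)[b, Z] = [R(V)b, R(V)Z]» (transport is an algebra automorphism; the regrouping step of (3.71)) and `D¹*_ν =
−R(U(x,x−e_ν))∘D¹_ν∘shift` ((3.8) with (3.5)) — are pv27's `B9Eq371Composition.R_ad` / `covDstar_eq_neg_R_covD`, stated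
there under `[NormedRing 𝔸]`; §1 below works over an arbitrary `Ring` and re-derives them as PRIVATE three-line helpers from
`B9Eq39Adjoint`'s `R_sub`/`R_mul_R`/`R_inv_R` (that module is not imported: it would add the (3.71) closure to every
importer of this scalar-side file for two ring identities).

WHAT IS IN PRINT («…» verbatim).  B9 p. 400 (3.52): «(V′₁(A)λ)(x) = Σ_{b∈st(x)} i[A′(b), (D_Uλ)(b)] + i[(D*_U A)(x), λ(x)]
+ Σ_{b∈st(x)} F′_{1,k}(iad_{A′(b)})λ(b₊), (3.52)», «Δ_{U′U} = Δ_U − V′₁(A). (3.53)», with «A′(b) = A(b) for positively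
oriented bonds b, and A′(b) = R(U_b)A(b) for negatively oriented b»; p. 401 (3.54): «|(V′₁(A)λ)(x)| ≦ 4dα₁(Lʲη)⁻¹|∇_Uλ| +
2dα₁(Lʲη)⁻²|λ| + 8dα₁²(Lʲη)⁻²|λ|, (3.54) the norms on the right-hand side involve only nearest neighbours of x because V′₁
is local»; p. 396 (3.37): «|A′| < α₁(Lʲη)⁻¹, |∇^η_UA′| < α₁(Lʲη)⁻² on Ω_j».  B8 p. 91: «consider for example a term
(ad_{λ(b₋)})ⁿA_b, ηD*_μ(ad_{λ(x)})ⁿA_μ(x) = R(U₀(x, x−ηe_μ))(ad_{λ(x−ηe_μ)})ⁿA_μ(x−ηe_μ) − (ad_{λ(x)})ⁿA_μ(x) =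
(ad_{R(U₀(x,x−ηe_μ))λ(x−ηe_μ)})ⁿR(U₀(x, x−ηe_μ))A_μ(x−ηe_μ) − (ad_{λ(x)})ⁿA_μ(x) = (ηad_{(D*_μλ)(x)} + ad_{λ(x)})ⁿ(η(D*_μA_μ)(x)
+ A_μ(x)) − (ad_{λ(x)})ⁿA_μ(x), (1.86) hence D*_μ(ad_{λ(x)})ⁿA_μ(x) = (ad_{λ(x)})ⁿ(D*_μA_μ)(x) + P_n(λ(x), D*_μλ(x), A_μ(x),
A_μ(x−ηe_μ)), (1.87)».  For `n = 1`, (1.86) gives `P₁ = ad_{(D*_μλ)(x)}(η(D*_μA_μ)(x) + A_μ(x)) = ad_{(D*_μλ)(x)}R(U₀(x,x−ηe_μ))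
A_μ(x−ηe_μ)`: the backward covariant difference passes the pointwise `ad` at the price of ONE commutator with the
DIFFERENCE OF THE COEFFICIENT, applied to the transported neighbour value.

WHY (the gap this closes, cell record).  The Sect. B chain of B9 bounds `V′₁`, `V₁`, `V₂` in GRADIENT form ((3.54), (3.61),
(3.73): the covariant difference on the ARGUMENT `λ`/`A′`); the right sup-entries (3.42)₃ of `G′(U′U)`, `G(U′U)` and the
entries `P′D*`, `DP′D*` of (3.68) need the difference on the LEFT of the coefficient (divergence form), which in print is
the silent lattice Leibniz rule with the coefficient differences bounded through (3.37).  This seat's gen-7 files reduced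
that reading to ONE abstract letter `hComm : V¹∇ − ∇V¹ ≺ c_Kα₁(Lʲη)⁻²e^{−δd}` (`B9Ineq386RightEntry` §5,
`B9Ineq368PPrimeDs` §5; ref-4 P2 gen 14 NOTE on p254763 «divergence-form reading = hypothesis, declared»).  THIS FILE is
the concrete half: on the carrier where `V′₁(A)` is DEFINED (`B9Eq352ScalarFluct.V1p`) the commutator letters ARE
`ad_{(∇_μA_μ)(x)}∘τ_μ` and `ad_{(∇*_μ τ*_μA_μ)(x)}∘τ*_μ`, direction by direction, with the (3.37) sizes.

WHAT THIS FILE PROVES (0 sorry; every declaration is a definition with a body or a theorem; no `def … : Prop`).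
* §1 (any ring `𝔸`, arbitrary units, arbitrary bijections as shifts — as `B9Eq39Adjoint`): the pointwise letter `adOp a λ =
  (x ↦ [a(x), λ(x)])`, the transported shifts `tauF` (`τ_μλ(x) = R(U_μ(x))λ(x+e_μ) = (D¹_μλ)(x) + λ(x)`) and `tauB` (`τ*_μλ(x)
  = R(U(x,x−e_μ))λ(x−e_μ) = (D¹*_μλ)(x) + λ(x)`); **`covD_adOp`** (forward Leibniz: `D¹_μ(ad_aλ)(x) = ad_{a(x)}(D¹_μλ)(x) +
  ad_{(D¹_μa)(x)}(τ_μλ)(x)`) and **`covDstar_adOp`** (= [B8] (1.87), `n = 1`: `D¹*_μ(ad_aλ)(x) = ad_{a(x)}(D¹*_μλ)(x) +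
  ad_{(D¹*_μa)(x)}(τ*_μλ)(x)`), EXACT; the commutator forms `ad_covD_eq`/`ad_covDstar_eq` (`ad_a∇ = ∇ad_a − ad_{∇a}τ`);
  `covD_tauB` (`D¹_μ(τ*_μa) = −D¹*_μa`), `covDstar_tauB` (`D¹*_μ` commutes with `τ*_μ`); the `η`-scaled forms.
* §2 (complete normed `ℂ`-algebra, as `B9Eq352ScalarFluct` §2): **`divPart`** = `Σ_μ (i∇_μ(ad_{A_μ}λ)(x) −
  i∇*_μ(ad_{τ*_μA_μ}λ)(x))` — the print's `Σ_{b∈st(x)} i[A′(b), (D_Uλ)(b)]` with the difference moved OUTSIDE (`∇ = η⁻¹D¹`,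
  `∇* = η⁻¹D¹*`; on the backward bond `⟨x, x−ηe_μ⟩` the print's `A′(b)` is `−τ*_μA_μ(x)` and `(D_Uλ)(b) = ∇*_μλ(x)`, cf.
  `B9Eq352ScalarFluct.V1p_eq_firstOrder`); **`commPart`** = `Σ_μ (i ad_{(∇_μA_μ)(x)}(τ_μλ)(x) − i ad_{(∇*_μτ*_μA_μ)(x)}(τ*_μλ)(x))`
  — THE COMMUTATOR LETTERS `[V¹, ∇]λ`; **`firstOrder_eq_divPart_sub_commPart`** (the first-order part of (3.52) = `divPart −
  commPart`, EXACT); **`zerothPart`** = `−commPart − i[(D*_UA)(x), λ(x)] + Σ_{b∈st(x)} F′_{1,k}(iad_{A′(b)})R(U_b)λ(b₊)` (every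
  term of order zero in `λ`); **`V1p_eq_divForm`** — `V′₁(A)λ = divPart + zerothPart`, i.e. `V′₁(A) = Σ_{b∈st(x)} ∇_b∘
  (i ad_{A′(b)}) + C′₁(A)`, EXACT for `η ≠ 0`; `eq353_divForm` — (3.53) in this form.
* §3 THE SIZES, `O(1)` explicit, from LOCAL hypotheses at the star of `x` (letters exactly as they occur; `d = card ι`):
  `norm_divCoeff_le` (the divergence-form coefficient `i ad_{A′(b)}` has size `2|A′(b)|`: `≦ 2α₁(Lʲη)⁻¹` under (3.37));
  **`norm_commPart_le`** (`‖commPart‖ ≦ 4d·g·Λ₀` when the coefficient differences `∇_μA_μ(x)`, `∇*_μτ*_μA_μ(x)` have norm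
  `≦ g` and the transported neighbour values of `λ` norm `≦ Λ₀`); **`norm_zerothPart_le`** (`‖C′₁(A)λ(x)‖ ≦ 4d·g·Λ₀ + 2·g′·Λ₀
  + 4d·a²e^{2ηa}·Λ₀`, `g′` bounding `(D*_UA)(x)`, `a` the fluctuation letters, as in `B9Eq352ScalarFluct.norm_V1p_le`);
  **`norm_zerothPart_le_printed`** — under (3.37) read at the star of `x` (`|A′(b)| ≦ α₁s⁻¹`, `|∇A|`-letters `≦ α₁s⁻²`,
  `|D*A(x)| ≦ dα₁s⁻²`, `s = Lʲη`, `ηα₁s⁻¹ ≦ 1/4`): `‖C′₁(A)λ(x)‖ ≦ 6dα₁(Lʲη)⁻²Λ₀ + 8dα₁²(Lʲη)⁻²Λ₀` — the (3.54) constants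
  with the gradient term `4dα₁(Lʲη)⁻¹|∇_Uλ|` traded for `4dα₁(Lʲη)⁻²|λ|`; `norm_covDstar_tauB_le` (the starred coefficient
  difference is a doubly transported FORWARD difference two steps back: `‖∇*_μτ*_μA_μ(x)‖ ≦ ρ⁴‖∇_μA_μ(x−2e_μ)‖` for transports
  of size `≦ ρ`, `= ‖∇_μA_μ(x−2e_μ)‖` for a unitary background in an operator norm).
* §4 SANITY (`example`s): `A = 0 ⟹ divPart = commPart = 0`; over a commutative carrier `commPart = 0`.

HONEST SCOPE / NOT CLAIMED.  (i) Norms are the abstract `NormedRing` norm of `𝔸` (cell DIVERGENCE D-r1.1: for a unitary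
background in an operator norm the transports are isometries and the transported letters have the sizes of the
untransported ones); the `Ω_j`/`st(b)` geometry is not modelled — the hypotheses are placed at the points the letters
actually read (nearest and, for the starred coefficient difference, next-nearest neighbours of `x`), the scale `s = Lʲη`
is a binder (the p. 398 convention «we can take either Lʲη, or L^{j′}η … this changes the constant δ₀ only» covers
neighbours across a block boundary).  (ii) This file does NOT restate the abstract letters of `B9Ineq386RightEntry` /
`B9Ineq368PPrimeDs` (`HasMajorant` over real-coordinate functions `W → ℝ`): the passage from the pointwise `𝔸`-valued
bounds here to block majorants is the cell's kernel-dictionary seam (choice of real coordinates of 𝔤; recorded by p06 g5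
in `B9Ineq3137From149` as «NOT bridged»), addressed on the abstract side by the sibling `B9Ineq386CommSum` (same seat,
same gen: range-1 local letters ⇒ block majorants, and the commutator device for the printed finite sum `Σ_{b∈st(x)}`).
(iii) The VECTOR operators `V₁(A)`, `V₂(A)` of (3.71)/(3.75) (pv27's `B9Eq371Composition.V₁op`, `B9Eq375Composition`)
are sums of terms of the same two shapes (coefficient `iad_{A}`, possibly transported, times a forward/backward covariant
difference of the argument); §1's two identities apply to them term by term — NOT carried out here.  (iv) The sign of the
middle commutator `i[(D*_UA)(x), λ(x)]` is as the kernel proves it (`B9Eq352ScalarFluct` READING NOTE), invisible in the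
bounds.  Value = the undisplayed lattice Leibniz step of Sect. B kernel-checked on the carrier where `V′₁(A)` is defined,
with constants; NOT summit progress, NOT a claim about any disputed step of the series.

RELATED IN THE TREE, NOT DUPLICATED (searched 2026-08-21: `ls Balaban1983to89 | grep -i 'Leibniz\|Commutator\|DivForm'` =
`B5Leibniz121` (B5 (1.121): scalar weighted graph Laplacian `[mulOp a, Δ_w]` on `EuclideanSpace`, no transports),
`B8Eq186AdCommutator` (B8 (1.86)–(1.87) for all `n` on the B8 carrier `B8Ineq132.covDeriv`/`B7Prop1Explicit.Site` — its
`covDeriv_adR` is the `n = 1` backward identity THERE; different carrier, different letters, not importable into the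
`B9Eq39Adjoint` vocabulary without a second dictionary), `B11Eq93Commutator`, `B4…Commutator…`, `B5Commutator128`,
`B6Eq239Commutator` (other papers' commutators, unrelated objects); `grep -n 'covD_ad\|adOp' B9*.lean` = ∅).  pv27's
`B9Eq371Composition`/`B9Eq375Composition` kernel-check (3.71)/(3.75) AS PRINTED (gradient form) and do not regroup into
divergence form; their `R_ad`, `covDstar_eq_neg_R_covD`, `norm_R_le_sq` (normed-ring level) are the same elementary steps as
the private helpers of §1/§3 here.
-/

noncomputable section

namespace Literature.MathematicalPhysics.QuantumFieldTheory.Balaban1983to89.B9Eq352DivForm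

open NormedSpace Complex
open Literature.MathematicalPhysics.QuantumFieldTheory.Balaban1983to89
open Literature.MathematicalPhysics.QuantumFieldTheory.Balaban1983to89.Beta.BackgroundVertices (ad norm_ad_le ad_smul_left
  ad_smul_right ad_add_right ad_sub_right ad_add_left ad_sub_left ad_neg_left ad_apply)
open Literature.MathematicalPhysics.QuantumFieldTheory.Balaban1983to89.B9Eq39Adjoint
open Literature.MathematicalPhysics.QuantumFieldTheory.Balaban1983to89.B9Eq370Expansion
open Literature.MathematicalPhysics.QuantumFieldTheory.Balaban1983to89.B9Eq352ScalarFluct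

/-! ## §1  The pointwise `ad` letter, the transported shifts, and the lattice Leibniz rule ([B8] (1.86)–(1.87), `n = 1`) -/

section Leibniz

variable {𝔸 : Type*} [Ring 𝔸] {S : Type*} {ι : Type*}
variable (T : ι → Equiv.Perm S) (U : ι → S → 𝔸ˣ)

omit T U in
/-- `R(V)[b, Z] = [R(V)b, R(V)Z]` — transport is an algebra automorphism (ring-level twin of pv27's
`B9Eq371Composition.R_ad`, which is stated under `[NormedRing 𝔸]`). [folklore] [cite: Balaban1985BackgroundPropagators, (3.71) p.404] -/
private theorem R_ad_ring (V : 𝔸ˣ) (b Z : 𝔸) : R V (ad b Z) = ad (R V b) (R V Z) := by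
  rw [ad_apply, ad_apply, R_sub, R_mul_R, R_mul_R]

/-- `D¹*_ν G(x) = −R(U_ν(y))⁻¹(D¹_νG)(y)`, `y = x − e_ν` ((3.8) along the reversed bond, (3.5); ring-level twin of pv27's
`B9Eq371Composition.covDstar_eq_neg_R_covD`). [folklore] [cite: Balaban1985BackgroundPropagators, (3.8) p.392, (3.5) p.391] -/
private theorem covDstar_eq_neg_transport (ν : ι) (G : S → 𝔸) (x : S) :
    covDstar T U ν G x = -R (U ν ((T ν).symm x))⁻¹ (covD T U ν G ((T ν).symm x)) := by
  simp only [covDstar, covD, R_sub, R_inv_R, Equiv.apply_symm_apply]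
  abel

/-- The pointwise commutator letter `(ad_a λ)(x) = [a(x), λ(x)]` — the shape of the coefficients `iad_{A′(b)}` of (3.52) and
`iad_{A_ν(x)}` of (3.71)/(3.75) acting on the value of the argument at the same point.
[cite: Balaban1985BackgroundPropagators, (3.52) p.400] -/
def adOp (a lam : S → 𝔸) : S → 𝔸 := fun x => ad (a x) (lam x)

/-- The forward transported shift `(τ_μλ)(x) = R(U(x, x+ηe_μ))λ(x+ηe_μ)` (the print's `R(U_b)λ(b₊)` on the forward bond).
[cite: Balaban1985BackgroundPropagators, (3.50) p.400, (3.3) p.390] -/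
def tauF (μ : ι) (lam : S → 𝔸) (x : S) : 𝔸 := R (U μ x) (lam (T μ x))

/-- The backward transported shift `(τ*_μλ)(x) = R(U(x, x−ηe_μ))λ(x−ηe_μ) = R(U_μ(x−e_μ))⁻¹λ(x−e_μ)` (the print's
`R(U_b)λ(b₊)` on the backward bond, (3.5)). [cite: Balaban1985BackgroundPropagators, (3.50) p.400, (3.5) p.391] -/
def tauB (μ : ι) (lam : S → 𝔸) (x : S) : 𝔸 := R (U μ ((T μ).symm x))⁻¹ (lam ((T μ).symm x))

omit T U in
/-- Unfolding `adOp`. [cite: Balaban1985BackgroundPropagators, (3.52) p.400] -/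
theorem adOp_apply (a lam : S → 𝔸) (x : S) : adOp a lam x = ad (a x) (lam x) := rfl

/-- Unfolding `tauF`. [cite: Balaban1985BackgroundPropagators, (3.50) p.400] -/
theorem tauF_apply (μ : ι) (lam : S → 𝔸) (x : S) : tauF T U μ lam x = R (U μ x) (lam (T μ x)) := rfl

/-- Unfolding `tauB`. [cite: Balaban1985BackgroundPropagators, (3.50) p.400] -/
theorem tauB_apply (μ : ι) (lam : S → 𝔸) (x : S) :
    tauB T U μ lam x = R (U μ ((T μ).symm x))⁻¹ (lam ((T μ).symm x)) := rfl

/-- `τ_μλ(x) = (D¹_μλ)(x) + λ(x)` — the print's «η(D_μA_μ)(x) + A_μ(x)» regrouping of (1.86), forward bond.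
[cite: Balaban1985RegularSpaces, (1.86) p.91; Balaban1985BackgroundPropagators, (3.3) p.390] -/
theorem tauF_eq_covD_add (μ : ι) (lam : S → 𝔸) (x : S) : tauF T U μ lam x = covD T U μ lam x + lam x := by
  simp only [tauF, covD, sub_add_cancel]

/-- `τ*_μλ(x) = (D¹*_μλ)(x) + λ(x)` — «η(D*_μA_μ)(x) + A_μ(x) = R(U₀(x, x−ηe_μ))A_μ(x−ηe_μ)» of (1.86).
[cite: Balaban1985RegularSpaces, (1.86) p.91; Balaban1985BackgroundPropagators, (3.8) p.392] -/
theorem tauB_eq_covDstar_add (μ : ι) (lam : S → 𝔸) (x : S) : tauB T U μ lam x = covDstar T U μ lam x + lam x := by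
  simp only [tauB, covDstar, sub_add_cancel]

/-- **Lattice Leibniz rule, forward bond**: `D¹_μ(ad_aλ)(x) = ad_{a(x)}(D¹_μλ)(x) + ad_{(D¹_μa)(x)}(τ_μλ)(x)` — the forward
twin of [B8] (1.87) with `n = 1` (`R(U)` is an algebra automorphism: `B9Eq371Composition.R_ad`), EXACT over any ring.
[cite: Balaban1985RegularSpaces, (1.86)–(1.87) p.91; Balaban1985BackgroundPropagators, (3.52) p.400 + p.405] -/
theorem covD_adOp (μ : ι) (a lam : S → 𝔸) (x : S) :
    covD T U μ (adOp a lam) x = ad (a x) (covD T U μ lam x) + ad (covD T U μ a x) (tauF T U μ lam x) := by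
  simp only [covD, adOp, tauF]
  rw [R_ad_ring, ad_sub_right, ad_sub_left]
  abel

/-- **Lattice Leibniz rule, backward bond** = [B8] (1.87), `n = 1`: `D¹*_μ(ad_aλ)(x) = ad_{a(x)}(D¹*_μλ)(x) +
ad_{(D¹*_μa)(x)}(τ*_μλ)(x)` («D*_μ(ad_{λ(x)})ⁿA_μ(x) = (ad_{λ(x)})ⁿ(D*_μA_μ)(x) + P_n(…)» with `P₁ = ad_{(D*_μλ)(x)}(η(D*_μA_μ)(x) +
A_μ(x))`), EXACT over any ring. [cite: Balaban1985RegularSpaces, (1.86)–(1.87) p.91] -/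
theorem covDstar_adOp (μ : ι) (a lam : S → 𝔸) (x : S) :
    covDstar T U μ (adOp a lam) x
      = ad (a x) (covDstar T U μ lam x) + ad (covDstar T U μ a x) (tauB T U μ lam x) := by
  simp only [covDstar, adOp, tauB]
  rw [R_ad_ring, ad_sub_right, ad_sub_left]
  abel

/-- **The commutator letter, forward**: `ad_{a(x)}(D¹_μλ)(x) = D¹_μ(ad_aλ)(x) − ad_{(D¹_μa)(x)}(τ_μλ)(x)` — gradient form =
divergence form minus `[ad_a, D¹_μ] = ad_{D¹_μa}∘τ_μ`. [cite: Balaban1985RegularSpaces, (1.87) p.91; Balaban1985BackgroundPropagators, (3.52) p.400] -/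
theorem ad_covD_eq (μ : ι) (a lam : S → 𝔸) (x : S) :
    ad (a x) (covD T U μ lam x) = covD T U μ (adOp a lam) x - ad (covD T U μ a x) (tauF T U μ lam x) := by
  rw [covD_adOp, add_sub_cancel_right]

/-- **The commutator letter, backward**: `ad_{a(x)}(D¹*_μλ)(x) = D¹*_μ(ad_aλ)(x) − ad_{(D¹*_μa)(x)}(τ*_μλ)(x)`.
[cite: Balaban1985RegularSpaces, (1.87) p.91; Balaban1985BackgroundPropagators, (3.52) p.400] -/
theorem ad_covDstar_eq (μ : ι) (a lam : S → 𝔸) (x : S) :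
    ad (a x) (covDstar T U μ lam x)
      = covDstar T U μ (adOp a lam) x - ad (covDstar T U μ a x) (tauB T U μ lam x) := by
  rw [covDstar_adOp, add_sub_cancel_right]

/-- `D¹_μ(τ*_μa)(x) = −(D¹*_μa)(x)`: the forward difference of the backward-transported coefficient is minus its backward
difference ((3.8) along the reversed bond, (3.5)). [cite: Balaban1985BackgroundPropagators, (3.8) p.392, (3.5) p.391] -/
theorem covD_tauB (μ : ι) (a : S → 𝔸) (x : S) : covD T U μ (tauB T U μ a) x = -covDstar T U μ a x := by
  simp only [covD, tauB, covDstar, Equiv.symm_apply_apply, R_R_inv]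
  abel

/-- `D¹*_μ` commutes with `τ*_μ`: `D¹*_μ(τ*_μa)(x) = τ*_μ(D¹*_μa)(x)` (`D¹*_μ = τ*_μ − 1`).
[cite: Balaban1985BackgroundPropagators, (3.8) p.392] -/
theorem covDstar_tauB (μ : ι) (a : S → 𝔸) (x : S) :
    covDstar T U μ (tauB T U μ a) x = tauB T U μ (covDstar T U μ a) x := by
  simp only [covDstar, tauB, R_sub]

/-- The starred coefficient difference written through a FORWARD difference two steps back:
`D¹*_μ(τ*_μa)(x) = −R(U_μ(y))⁻¹R(U_μ(z))⁻¹(D¹_μa)(z)`, `y = x − e_μ`, `z = x − 2e_μ`.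
[cite: Balaban1985BackgroundPropagators, (3.8) p.392, (3.39) p.397] -/
theorem covDstar_tauB_eq_fwd (μ : ι) (a : S → 𝔸) (x : S) :
    covDstar T U μ (tauB T U μ a) x
      = -R (U μ ((T μ).symm x))⁻¹
          (R (U μ ((T μ).symm ((T μ).symm x)))⁻¹ (covD T U μ a ((T μ).symm ((T μ).symm x)))) := by
  rw [covDstar_tauB, tauB, covDstar_eq_neg_transport, R_neg]

end Leibniz

/-! ## §1b  The `η`-scaled forms (`∇ = η⁻¹D¹`, `∇* = η⁻¹D¹*`) -/

section Scaled

variable {𝔸 : Type*} [Ring 𝔸] [Algebra ℂ 𝔸] {S : Type*} {ι : Type*}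
variable (T : ι → Equiv.Perm S) (U : ι → S → 𝔸ˣ)

/-- Forward commutator letter at scale `η`: `ad_{a(x)}(c·D¹_μλ)(x) = c·D¹_μ(ad_aλ)(x) − ad_{(c·D¹_μa)(x)}(τ_μλ)(x)` (`c = η⁻¹`:
`ad_a∇_μ = ∇_μad_a − ad_{∇_μa}τ_μ`). [cite: Balaban1985RegularSpaces, (1.87) p.91; Balaban1985BackgroundPropagators, (3.52) p.400] -/
theorem ad_smul_covD_eq (c : ℂ) (μ : ι) (a lam : S → 𝔸) (x : S) :
    ad (a x) (c • covD T U μ lam x)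
      = c • covD T U μ (adOp a lam) x - ad (c • covD T U μ a x) (tauF T U μ lam x) := by
  rw [ad_smul_right, ad_covD_eq, smul_sub, ← ad_smul_left]

/-- Backward commutator letter at scale `η`: `ad_{a(x)}(c·D¹*_μλ)(x) = c·D¹*_μ(ad_aλ)(x) − ad_{(c·D¹*_μa)(x)}(τ*_μλ)(x)`.
[cite: Balaban1985RegularSpaces, (1.87) p.91; Balaban1985BackgroundPropagators, (3.52) p.400] -/
theorem ad_smul_covDstar_eq (c : ℂ) (μ : ι) (a lam : S → 𝔸) (x : S) :
    ad (a x) (c • covDstar T U μ lam x)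
      = c • covDstar T U μ (adOp a lam) x - ad (c • covDstar T U μ a x) (tauB T U μ lam x) := by
  rw [ad_smul_right, ad_covDstar_eq, smul_sub, ← ad_smul_left]

end Scaled

/-! ## §2  `V′₁(A)` in divergence form -/

section DivForm

variable {𝔸 : Type*} [NormedRing 𝔸] [NormedAlgebra ℂ 𝔸] [CompleteSpace 𝔸] {S : Type*} {ι : Type*} [Fintype ι]
variable (T : ι → Equiv.Perm S) (U : ι → S → 𝔸ˣ)

/-- **The divergence-form part of `V′₁(A)`**: `Σ_μ (i∇_μ(ad_{A_μ}λ)(x) − i∇*_μ(ad_{τ*_μA_μ}λ)(x))` — the print's first-order sum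
`Σ_{b∈st(x)} i[A′(b), (D_Uλ)(b)]` of (3.52) with the covariant difference moved outside the coefficient: `Σ_{b∈st(x)}
(∇_b (i ad_{A′(b)}λ))` (forward bond: `∇_μ`, coefficient `A_μ`; backward bond `⟨x, x−ηe_μ⟩`: `∇*_μ`, coefficient
`τ*_μA_μ = −A′(b)`, as in `B9Eq352ScalarFluct.V1p_eq_firstOrder`). [cite: Balaban1985BackgroundPropagators, (3.52) p.400] -/
def divPart (η : ℝ) (A : ι → S → 𝔸) (lam : S → 𝔸) (x : S) : 𝔸 :=
  ∑ μ, ((I : ℂ) • (((η : ℂ)⁻¹) • covD T U μ (adOp (A μ) lam) x)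
    - (I : ℂ) • (((η : ℂ)⁻¹) • covDstar T U μ (adOp (tauB T U μ (A μ)) lam) x))

/-- **The commutator letters `[V¹, ∇]λ` of `V′₁(A)`**: `Σ_μ (i ad_{(∇_μA_μ)(x)}(τ_μλ)(x) − i ad_{(∇*_μτ*_μA_μ)(x)}(τ*_μλ)(x))` —
one commutator with a covariant DIFFERENCE OF THE COEFFICIENT per bond of `st(x)`, applied to the transported neighbour
value (the `P₁`-terms of [B8] (1.87)). [cite: Balaban1985BackgroundPropagators, (3.52) p.400 + (3.37) p.396; Balaban1985RegularSpaces, (1.87) p.91] -/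
def commPart (η : ℝ) (A : ι → S → 𝔸) (lam : S → 𝔸) (x : S) : 𝔸 :=
  ∑ μ, ((I : ℂ) • ad (((η : ℂ)⁻¹) • covD T U μ (A μ) x) (tauF T U μ lam x)
    - (I : ℂ) • ad (((η : ℂ)⁻¹) • covDstar T U μ (tauB T U μ (A μ)) x) (tauB T U μ lam x))

omit [CompleteSpace 𝔸] in
/-- **The first-order part of (3.52) in divergence form, EXACTLY**: `Σ_{b∈st(x)} i[A′(b), (D_Uλ)(b)] = divPart − commPart`
(per direction: `ad_smul_covD_eq`, `ad_smul_covDstar_eq`). [cite: Balaban1985BackgroundPropagators, (3.52) p.400; Balaban1985RegularSpaces, (1.87) p.91] -/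
theorem firstOrder_eq_divPart_sub_commPart (η : ℝ) (A : ι → S → 𝔸) (lam : S → 𝔸) (x : S) :
    (∑ μ, ((I : ℂ) • ad (A μ x) (((η : ℂ)⁻¹) • covD T U μ lam x)
        - (I : ℂ) • ad (R (U μ ((T μ).symm x))⁻¹ (A μ ((T μ).symm x))) (((η : ℂ)⁻¹) • covDstar T U μ lam x)))
      = divPart T U η A lam x - commPart T U η A lam x := by
  rw [divPart, commPart, ← Finset.sum_sub_distrib]
  refine Finset.sum_congr rfl fun μ _ => ?_
  have hb : R (U μ ((T μ).symm x))⁻¹ (A μ ((T μ).symm x)) = tauB T U μ (A μ) x := rfl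
  rw [hb, ad_smul_covD_eq, ad_smul_covDstar_eq, smul_sub, smul_sub]
  abel

/-- **`C′₁(A)λ(x)`, the zeroth-order part of `V′₁(A)` in divergence form**: `−[V¹, ∇]λ(x) − i[(D*_UA)(x), λ(x)] +
Σ_{b∈st(x)} F′_{1,k}(iad_{A′(b)})R(U_b)λ(b₊)` (`D*A = η⁻¹·divB A`, (3.8); the remainders `F′_{1,k}` as
`B9Eq352ScalarFluct.Fp1`; sign of the middle term as the kernel proves it, `B9Eq352ScalarFluct` READING NOTE).
[cite: Balaban1985BackgroundPropagators, (3.52) p.400] -/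
def zerothPart (η : ℝ) (A : ι → S → 𝔸) (lam : S → 𝔸) (x : S) : 𝔸 :=
  -commPart T U η A lam x - (I : ℂ) • ad (((η : ℂ)⁻¹) • divB T U A x) (lam x)
    + ∑ μ, (Fp1 η (A μ x) (R (U μ x) (lam (T μ x)))
      + Fp1 η (-(R (U μ ((T μ).symm x))⁻¹ (A μ ((T μ).symm x)))) (R (U μ ((T μ).symm x))⁻¹ (lam ((T μ).symm x))))

omit [CompleteSpace 𝔸] in
/-- **`V′₁(A)` IN DIVERGENCE FORM, EXACTLY** (`η ≠ 0`): `(V′₁(A)λ)(x) = divPart + zerothPart`, i.e.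
`V′₁(A) = Σ_{b∈st(x)} ∇_b∘(i ad_{A′(b)}) + C′₁(A)` with `C′₁(A)` of order zero in `λ` — (3.52) regrouped by the lattice
Leibniz rule [B8] (1.87). [cite: Balaban1985BackgroundPropagators, (3.52)–(3.53) p.400; Balaban1985RegularSpaces, (1.86)–(1.87) p.91] -/
theorem V1p_eq_divForm (η : ℝ) (hη : η ≠ 0) (A : ι → S → 𝔸) (lam : S → 𝔸) (x : S) :
    V1p T U η A lam x = divPart T U η A lam x + zerothPart T U η A lam x := by
  rw [V1p_eq_firstOrder T U η hη A lam x, firstOrder_eq_divPart_sub_commPart, zerothPart]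
  abel

/-- **(3.53) in divergence form**: `Δ_{U′U}λ = Δ_Uλ − Σ_{b∈st(x)} ∇_b(i ad_{A′(b)}λ) − C′₁(A)λ` (`η ≠ 0`).
[cite: Balaban1985BackgroundPropagators, (3.53) p.400; Balaban1985RegularSpaces, (1.87) p.91] -/
theorem eq353_divForm (η : ℝ) (hη : η ≠ 0) (A : ι → S → 𝔸) (lam : S → 𝔸) (x : S) :
    siteLap T (prodCfg U η A) η lam x
      = siteLap T U η lam x - divPart T U η A lam x - zerothPart T U η A lam x := by
  rw [eq353, V1p_eq_divForm T U η hη, sub_add_eq_sub_sub]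

end DivForm

/-! ## §3  The sizes, `O(1)` explicit -/

section Bounds

variable {𝔸 : Type*} [NormedRing 𝔸] [NormedAlgebra ℂ 𝔸] [CompleteSpace 𝔸] {S : Type*} {ι : Type*} [Fintype ι]
variable (T : ι → Equiv.Perm S) (U : ι → S → 𝔸ˣ)

omit [CompleteSpace 𝔸] in
/-- `‖i·X‖ = ‖X‖` — elementary API for the bounds. [folklore] [cite: Balaban1985BackgroundPropagators, (3.54) p.401] -/
private theorem norm_I_smul (X : 𝔸) : ‖(I : ℂ) • X‖ = ‖X‖ := by
  rw [norm_smul, Complex.norm_I, one_mul]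

omit [CompleteSpace 𝔸] [Fintype ι] in
/-- **Size of the divergence-form coefficient**: `‖i[A′(b), λ(x)]‖ ≦ 2‖A′(b)‖‖λ(x)‖` — under (3.37) the letter `i ad_{A′(b)}`
has size `2α₁(Lʲη)⁻¹`, the `(Lʲη)⁻¹`-letter `B` of the divergence form. [cite: Balaban1985BackgroundPropagators, (3.52) p.400 + (3.37) p.396] -/
theorem norm_divCoeff_le (a lam : S → 𝔸) (x : S) : ‖(I : ℂ) • adOp a lam x‖ ≤ 2 * ‖a x‖ * ‖lam x‖ := by
  rw [norm_I_smul, adOp_apply]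
  exact norm_ad_le _ _

omit [NormedAlgebra ℂ 𝔸] [CompleteSpace 𝔸] in
/-- Transport size: `‖R(V)Z‖ ≦ ρ²‖Z‖` when `‖V‖, ‖V⁻¹‖ ≦ ρ` (`B9Eq370Expansion.norm_R_le`; pv27's
`B9Eq371Composition.norm_R_le_sq`). [folklore] [cite: Balaban1985BackgroundPropagators, (3.39) p.397] -/
private theorem norm_R_le_sq' (V : 𝔸ˣ) {ρ : ℝ} (h1 : ‖(V : 𝔸)‖ ≤ ρ) (h2 : ‖((V⁻¹ : 𝔸ˣ) : 𝔸)‖ ≤ ρ) (Z : 𝔸) :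
    ‖R V Z‖ ≤ ρ ^ 2 * ‖Z‖ := by
  have hρ : 0 ≤ ρ := (norm_nonneg _).trans h1
  calc ‖R V Z‖ ≤ ‖(V : 𝔸)‖ * ‖Z‖ * ‖((V⁻¹ : 𝔸ˣ) : 𝔸)‖ := norm_R_le V Z
    _ ≤ ρ * ‖Z‖ * ρ :=
        mul_le_mul (mul_le_mul_of_nonneg_right h1 (norm_nonneg Z)) h2 (norm_nonneg _) (mul_nonneg hρ (norm_nonneg Z))
    _ = ρ ^ 2 * ‖Z‖ := by ring

omit [NormedAlgebra ℂ 𝔸] [CompleteSpace 𝔸] [Fintype ι] in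
/-- **The starred coefficient difference has the size of a forward difference** (two steps back, two transports):
`‖D¹*_μ(τ*_μa)(x)‖ ≦ ρ²·ρ²·‖(D¹_μa)(x − 2e_μ)‖` when `‖U‖, ‖U⁻¹‖ ≦ ρ` on the two bonds behind `x` (`ρ = 1`: unitary background
in an operator norm, the print's `|∇A|`). [cite: Balaban1985BackgroundPropagators, (3.39) p.397, (3.8) p.392] -/
theorem norm_covDstar_tauB_le (μ : ι) (a : S → 𝔸) (x : S) {ρ : ℝ}
    (h1 : ‖((U μ ((T μ).symm x))⁻¹ : 𝔸ˣ).val‖ ≤ ρ) (h1' : ‖(((U μ ((T μ).symm x))⁻¹)⁻¹ : 𝔸ˣ).val‖ ≤ ρ)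
    (h2 : ‖((U μ ((T μ).symm ((T μ).symm x)))⁻¹ : 𝔸ˣ).val‖ ≤ ρ)
    (h2' : ‖(((U μ ((T μ).symm ((T μ).symm x)))⁻¹)⁻¹ : 𝔸ˣ).val‖ ≤ ρ) :
    ‖covDstar T U μ (tauB T U μ a) x‖ ≤ ρ ^ 2 * (ρ ^ 2 * ‖covD T U μ a ((T μ).symm ((T μ).symm x))‖) := by
  rw [covDstar_tauB_eq_fwd, norm_neg]
  refine (norm_R_le_sq' _ h1 h1' _).trans ?_
  have hρ : 0 ≤ ρ ^ 2 := sq_nonneg ρ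
  exact mul_le_mul_of_nonneg_left (norm_R_le_sq' _ h2 h2' _) hρ

omit [CompleteSpace 𝔸] in
/-- **Size of the commutator letters**: if the coefficient differences `∇_μA_μ(x)`, `∇*_μτ*_μA_μ(x)` have norm `≦ g` (`g ≧ 0`)
and the transported neighbour values `τ_μλ(x)`, `τ*_μλ(x)` norm `≦ Λ₀`, then `‖[V¹, ∇]λ(x)‖ ≦ 4d·g·Λ₀` (`2gΛ₀` per bond of
`st(x)`, `norm_ad_le`). [cite: Balaban1985BackgroundPropagators, (3.52) p.400 + (3.37) p.396 + (3.54) p.401] -/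
theorem norm_commPart_le (η : ℝ) (A : ι → S → 𝔸) (lam : S → 𝔸) (x : S) {g Λ₀ : ℝ} (hg : 0 ≤ g)
    (hG : ∀ μ, ‖((η : ℂ)⁻¹) • covD T U μ (A μ) x‖ ≤ g
      ∧ ‖((η : ℂ)⁻¹) • covDstar T U μ (tauB T U μ (A μ)) x‖ ≤ g)
    (hY : ∀ μ, ‖R (U μ x) (lam (T μ x))‖ ≤ Λ₀ ∧ ‖R (U μ ((T μ).symm x))⁻¹ (lam ((T μ).symm x))‖ ≤ Λ₀) :
    ‖commPart T U η A lam x‖ ≤ 4 * Fintype.card ι * g * Λ₀ := by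
  have h1 : ∀ μ, ‖(I : ℂ) • ad (((η : ℂ)⁻¹) • covD T U μ (A μ) x) (tauF T U μ lam x)
      - (I : ℂ) • ad (((η : ℂ)⁻¹) • covDstar T U μ (tauB T U μ (A μ)) x) (tauB T U μ lam x)‖
      ≤ 2 * g * Λ₀ + 2 * g * Λ₀ := by
    intro μ
    refine (norm_sub_le _ _).trans (add_le_add ?_ ?_)
    · rw [norm_I_smul]
      refine (norm_ad_le _ _).trans ?_
      have := (hG μ).1; have := (hY μ).1
      rw [tauF_apply]
      gcongr
    · rw [norm_I_smul]
      refine (norm_ad_le _ _).trans ?_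
      have := (hG μ).2; have := (hY μ).2
      rw [tauB_apply]
      gcongr
  rw [commPart]
  refine (norm_sum_le _ _).trans ?_
  calc ∑ μ, ‖(I : ℂ) • ad (((η : ℂ)⁻¹) • covD T U μ (A μ) x) (tauF T U μ lam x)
        - (I : ℂ) • ad (((η : ℂ)⁻¹) • covDstar T U μ (tauB T U μ (A μ)) x) (tauB T U μ lam x)‖
      ≤ ∑ _μ : ι, (2 * g * Λ₀ + 2 * g * Λ₀) := Finset.sum_le_sum fun μ _ => h1 μ
    _ = 4 * Fintype.card ι * g * Λ₀ := by
        rw [Finset.sum_const, Finset.card_univ, nsmul_eq_mul]; ring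

omit [NormedAlgebra ℂ 𝔸] [CompleteSpace 𝔸] [Fintype ι] in
/-- Monotonicity of the remainder constant in the letter size (as in `B9Eq352ScalarFluct`): `‖a‖ ≦ s ⟹ 2‖a‖²e^{2η‖a‖}‖Y‖ ≦
2s²e^{2ηs}‖Y‖` (`η ≧ 0`). [folklore] [cite: Balaban1985BackgroundPropagators, (3.54) p.401] -/
private theorem rem_const_mono {η s : ℝ} (hη : 0 ≤ η) {a Y : 𝔸} (ha : ‖a‖ ≤ s) :
    2 * ‖a‖ ^ 2 * Real.exp (2 * (η * ‖a‖)) * ‖Y‖ ≤ 2 * s ^ 2 * Real.exp (2 * (η * s)) * ‖Y‖ := by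
  have h0 : 0 ≤ ‖a‖ := norm_nonneg a
  have h1 : ‖a‖ ^ 2 ≤ s ^ 2 := pow_le_pow_left₀ h0 ha 2
  have h2 : Real.exp (2 * (η * ‖a‖)) ≤ Real.exp (2 * (η * s)) :=
    Real.exp_le_exp.mpr (by nlinarith)
  have h3 : 0 ≤ Real.exp (2 * (η * ‖a‖)) := (Real.exp_pos _).le
  gcongr

/-- **Size of `C′₁(A)λ(x)`, `O(1)` explicit, from local hypotheses at the star of `x`** (letters exactly as they occur): the
fluctuation letters `A′(b)` have norm `≦ a` (`a ≧ 0`), the coefficient differences `∇_μA_μ(x)`, `∇*_μτ*_μA_μ(x)` norm `≦ g`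
(`g ≧ 0`), `(D*_UA)(x)` norm `≦ g′`, `λ(x)` and the transported neighbour values `R(U_b)λ(b₊)` norm `≦ Λ₀`.  Then
`‖C′₁(A)λ(x)‖ ≦ 4d·g·Λ₀ + 2·g′·Λ₀ + 4d·a²e^{2ηa}·Λ₀` (`d = card ι`; commutator letters + divergence commutator + remainders).
[cite: Balaban1985BackgroundPropagators, (3.52) p.400 + (3.54) p.401 + (3.37) p.396] -/
theorem norm_zerothPart_le {η : ℝ} (hη : 0 < η) (A : ι → S → 𝔸) (lam : S → 𝔸) (x : S) {a g g' Λ₀ : ℝ}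
    (hg : 0 ≤ g)
    (hA : ∀ μ, ‖A μ x‖ ≤ a ∧ ‖R (U μ ((T μ).symm x))⁻¹ (A μ ((T μ).symm x))‖ ≤ a)
    (hG : ∀ μ, ‖((η : ℂ)⁻¹) • covD T U μ (A μ) x‖ ≤ g
      ∧ ‖((η : ℂ)⁻¹) • covDstar T U μ (tauB T U μ (A μ)) x‖ ≤ g)
    (hdiv : ‖((η : ℂ)⁻¹) • divB T U A x‖ ≤ g')
    (hl : ‖lam x‖ ≤ Λ₀)
    (hY : ∀ μ, ‖R (U μ x) (lam (T μ x))‖ ≤ Λ₀ ∧ ‖R (U μ ((T μ).symm x))⁻¹ (lam ((T μ).symm x))‖ ≤ Λ₀) :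
    ‖zerothPart T U η A lam x‖
      ≤ 4 * Fintype.card ι * g * Λ₀ + 2 * g' * Λ₀
        + 4 * Fintype.card ι * a ^ 2 * Real.exp (2 * (η * a)) * Λ₀ := by
  have hΛ₀ : 0 ≤ Λ₀ := (norm_nonneg _).trans hl
  -- the commutator letters
  have hS1 : ‖-commPart T U η A lam x‖ ≤ 4 * Fintype.card ι * g * Λ₀ := by
    rw [norm_neg]; exact norm_commPart_le T U η A lam x hg hG hY
  -- the divergence commutator
  have hS2 : ‖(I : ℂ) • ad (((η : ℂ)⁻¹) • divB T U A x) (lam x)‖ ≤ 2 * g' * Λ₀ := by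
    rw [norm_I_smul]
    refine (norm_ad_le _ _).trans ?_
    have hg0 : 0 ≤ g' := (norm_nonneg _).trans hdiv
    gcongr
  -- the remainders
  have h3 : ∀ μ, ‖Fp1 η (A μ x) (R (U μ x) (lam (T μ x)))
      + Fp1 η (-(R (U μ ((T μ).symm x))⁻¹ (A μ ((T μ).symm x)))) (R (U μ ((T μ).symm x))⁻¹ (lam ((T μ).symm x)))‖
      ≤ 2 * a ^ 2 * Real.exp (2 * (η * a)) * Λ₀ + 2 * a ^ 2 * Real.exp (2 * (η * a)) * Λ₀ := by
    intro μ
    have hE : 0 ≤ 2 * a ^ 2 * Real.exp (2 * (η * a)) := by positivity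
    refine (norm_add_le _ _).trans (add_le_add ?_ ?_)
    · refine (norm_Fp1_le hη _ _).trans ?_
      refine (rem_const_mono hη.le (hA μ).1).trans ?_
      exact mul_le_mul_of_nonneg_left (hY μ).1 hE
    · refine (norm_Fp1_le hη _ _).trans ?_
      have ha' : ‖-(R (U μ ((T μ).symm x))⁻¹ (A μ ((T μ).symm x)))‖ ≤ a := by rw [norm_neg]; exact (hA μ).2
      refine (rem_const_mono hη.le ha').trans ?_
      exact mul_le_mul_of_nonneg_left (hY μ).2 hE
  have hS3 : ‖∑ μ, (Fp1 η (A μ x) (R (U μ x) (lam (T μ x)))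
      + Fp1 η (-(R (U μ ((T μ).symm x))⁻¹ (A μ ((T μ).symm x)))) (R (U μ ((T μ).symm x))⁻¹ (lam ((T μ).symm x))))‖
      ≤ 4 * Fintype.card ι * a ^ 2 * Real.exp (2 * (η * a)) * Λ₀ := by
    refine (norm_sum_le _ _).trans ?_
    calc ∑ μ, ‖Fp1 η (A μ x) (R (U μ x) (lam (T μ x)))
          + Fp1 η (-(R (U μ ((T μ).symm x))⁻¹ (A μ ((T μ).symm x)))) (R (U μ ((T μ).symm x))⁻¹ (lam ((T μ).symm x)))‖
        ≤ ∑ _μ : ι, (2 * a ^ 2 * Real.exp (2 * (η * a)) * Λ₀ + 2 * a ^ 2 * Real.exp (2 * (η * a)) * Λ₀) :=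
          Finset.sum_le_sum fun μ _ => h3 μ
      _ = 4 * Fintype.card ι * a ^ 2 * Real.exp (2 * (η * a)) * Λ₀ := by
          rw [Finset.sum_const, Finset.card_univ, nsmul_eq_mul]; ring
  rw [zerothPart]
  calc ‖-commPart T U η A lam x - (I : ℂ) • ad (((η : ℂ)⁻¹) • divB T U A x) (lam x)
        + ∑ μ, (Fp1 η (A μ x) (R (U μ x) (lam (T μ x)))
          + Fp1 η (-(R (U μ ((T μ).symm x))⁻¹ (A μ ((T μ).symm x)))) (R (U μ ((T μ).symm x))⁻¹ (lam ((T μ).symm x))))‖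
      ≤ ‖-commPart T U η A lam x‖ + ‖(I : ℂ) • ad (((η : ℂ)⁻¹) • divB T U A x) (lam x)‖
        + ‖∑ μ, (Fp1 η (A μ x) (R (U μ x) (lam (T μ x)))
          + Fp1 η (-(R (U μ ((T μ).symm x))⁻¹ (A μ ((T μ).symm x)))) (R (U μ ((T μ).symm x))⁻¹ (lam ((T μ).symm x))))‖ :=
        (norm_add_le _ _).trans (add_le_add (norm_sub_le _ _) le_rfl)
    _ ≤ 4 * Fintype.card ι * g * Λ₀ + 2 * g' * Λ₀ + 4 * Fintype.card ι * a ^ 2 * Real.exp (2 * (η * a)) * Λ₀ :=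
        add_le_add_three hS1 hS2 hS3

/-- **`C′₁(A)` IN THE PRINTED REGIME (3.37).**  With the scale `s = Lʲη > 0` of the block of `x` and (3.37) read on the star of
`x` — `‖A′(b)‖ ≦ α₁s⁻¹` («|A′| < α₁(Lʲη)⁻¹»), the coefficient differences `‖∇_μA_μ(x)‖, ‖∇*_μτ*_μA_μ(x)‖ ≦ α₁s⁻²` («|∇^η_UA′| <
α₁(Lʲη)⁻²»; for the starred one see `norm_covDstar_tauB_le`), `‖(D*_UA)(x)‖ ≦ d·α₁s⁻²` (a sum of `d` covariant differences)
— and `ηα₁s⁻¹ ≦ 1/4` («for α₁ sufficiently small»: `e^{2α₁L^{−j}} ≦ 2`, `B9Eq352ScalarFluct.exp_two_mul_le_two`):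
`‖C′₁(A)λ(x)‖ ≦ 6dα₁(Lʲη)⁻²Λ₀ + 8dα₁²(Lʲη)⁻²Λ₀`, `Λ₀ = |λ|` over the nearest neighbours of `x` — the (3.54) constants with the
gradient term `4dα₁(Lʲη)⁻¹|∇_Uλ|` replaced by `4dα₁(Lʲη)⁻²|λ|`: the `(Lʲη)⁻²`-letter `C` of the divergence form.
[cite: Balaban1985BackgroundPropagators, (3.54) p.401 + (3.37) p.396 + (3.52) p.400] -/
theorem norm_zerothPart_le_printed {η : ℝ} (hη : 0 < η) (A : ι → S → 𝔸) (lam : S → 𝔸) (x : S) {α₁ s Λ₀ : ℝ}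
    (hα : 0 ≤ α₁) (hs : 0 < s) (hsmall : η * (α₁ * s⁻¹) ≤ 1 / 4)
    (hA : ∀ μ, ‖A μ x‖ ≤ α₁ * s⁻¹ ∧ ‖R (U μ ((T μ).symm x))⁻¹ (A μ ((T μ).symm x))‖ ≤ α₁ * s⁻¹)
    (hG : ∀ μ, ‖((η : ℂ)⁻¹) • covD T U μ (A μ) x‖ ≤ α₁ * (s⁻¹) ^ 2
      ∧ ‖((η : ℂ)⁻¹) • covDstar T U μ (tauB T U μ (A μ)) x‖ ≤ α₁ * (s⁻¹) ^ 2)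
    (hdiv : ‖((η : ℂ)⁻¹) • divB T U A x‖ ≤ Fintype.card ι * (α₁ * (s⁻¹) ^ 2))
    (hl : ‖lam x‖ ≤ Λ₀)
    (hY : ∀ μ, ‖R (U μ x) (lam (T μ x))‖ ≤ Λ₀ ∧ ‖R (U μ ((T μ).symm x))⁻¹ (lam ((T μ).symm x))‖ ≤ Λ₀) :
    ‖zerothPart T U η A lam x‖
      ≤ 6 * Fintype.card ι * α₁ * (s⁻¹) ^ 2 * Λ₀ + 8 * Fintype.card ι * α₁ ^ 2 * (s⁻¹) ^ 2 * Λ₀ := by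
  have ha : 0 ≤ α₁ * s⁻¹ := mul_nonneg hα (inv_nonneg.mpr hs.le)
  have hg : 0 ≤ α₁ * (s⁻¹) ^ 2 := mul_nonneg hα (sq_nonneg _)
  have hΛ₀ : 0 ≤ Λ₀ := (norm_nonneg _).trans hl
  have h := norm_zerothPart_le T U hη A lam x hg hA hG hdiv hl hY
  have he : Real.exp (2 * (η * (α₁ * s⁻¹))) ≤ 2 := exp_two_mul_le_two hsmall
  have hd : (0 : ℝ) ≤ Fintype.card ι := Nat.cast_nonneg _
  calc ‖zerothPart T U η A lam x‖
      ≤ 4 * Fintype.card ι * (α₁ * (s⁻¹) ^ 2) * Λ₀ + 2 * (Fintype.card ι * (α₁ * (s⁻¹) ^ 2)) * Λ₀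
        + 4 * Fintype.card ι * (α₁ * s⁻¹) ^ 2 * Real.exp (2 * (η * (α₁ * s⁻¹))) * Λ₀ := h
    _ ≤ 4 * Fintype.card ι * (α₁ * (s⁻¹) ^ 2) * Λ₀ + 2 * (Fintype.card ι * (α₁ * (s⁻¹) ^ 2)) * Λ₀
        + 4 * Fintype.card ι * (α₁ * s⁻¹) ^ 2 * 2 * Λ₀ := by
          have h4 : 0 ≤ 4 * Fintype.card ι * (α₁ * s⁻¹) ^ 2 := by positivity
          have := mul_le_mul_of_nonneg_left he h4
          nlinarith
    _ = 6 * Fintype.card ι * α₁ * (s⁻¹) ^ 2 * Λ₀ + 8 * Fintype.card ι * α₁ ^ 2 * (s⁻¹) ^ 2 * Λ₀ := by ring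

omit [CompleteSpace 𝔸] [Fintype ι] in
/-- **The divergence-form coefficient in the printed regime**: `‖i[A′(b), λ(x)]‖ ≦ 2α₁(Lʲη)⁻¹Λ₀` for both orientations of the
bonds of `st(x)`. [cite: Balaban1985BackgroundPropagators, (3.52) p.400 + (3.37) p.396] -/
theorem norm_divCoeff_le_printed (A : ι → S → 𝔸) (lam : S → 𝔸) (x : S) (μ : ι) {α₁ s Λ₀ : ℝ}
    (hA : ‖A μ x‖ ≤ α₁ * s⁻¹ ∧ ‖R (U μ ((T μ).symm x))⁻¹ (A μ ((T μ).symm x))‖ ≤ α₁ * s⁻¹) (hl : ‖lam x‖ ≤ Λ₀) :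
    ‖(I : ℂ) • adOp (A μ) lam x‖ ≤ 2 * (α₁ * s⁻¹) * Λ₀
      ∧ ‖(I : ℂ) • adOp (tauB T U μ (A μ)) lam x‖ ≤ 2 * (α₁ * s⁻¹) * Λ₀ := by
  have ha : 0 ≤ α₁ * s⁻¹ := (norm_nonneg _).trans hA.1
  refine ⟨(norm_divCoeff_le _ _ _).trans ?_, (norm_divCoeff_le _ _ _).trans ?_⟩
  · have := hA.1
    gcongr
  · have h2 : ‖tauB T U μ (A μ) x‖ ≤ α₁ * s⁻¹ := hA.2
    gcongr

end Bounds

/-! ## §4  Sanity -/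

section Examples

variable {𝔸 : Type*} [NormedRing 𝔸] [NormedAlgebra ℂ 𝔸] [CompleteSpace 𝔸] {S : Type*} {ι : Type*} [Fintype ι]
variable (T : ι → Equiv.Perm S) (U : ι → S → 𝔸ˣ)

/-- No fluctuation field, no divergence-form part. [folklore] -/
example (η : ℝ) (lam : S → 𝔸) (x : S) : divPart T U η (0 : ι → S → 𝔸) lam x = 0 := by
  simp [divPart, adOp, tauB, covD, covDstar, ad_apply]

/-- No fluctuation field, no commutator letters. [folklore] -/
example (η : ℝ) (lam : S → 𝔸) (x : S) : commPart T U η (0 : ι → S → 𝔸) lam x = 0 := by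
  simp [commPart, tauB, covD, covDstar, ad_apply]

/-- Over a COMMUTATIVE carrier the commutator letters vanish identically (the content is non-abelian). [folklore] -/
example {𝔹 : Type*} [NormedCommRing 𝔹] [NormedAlgebra ℂ 𝔹] [CompleteSpace 𝔹] (V : ι → S → 𝔹ˣ) (η : ℝ)
    (A : ι → S → 𝔹) (lam : S → 𝔹) (x : S) : commPart T V η A lam x = 0 := by
  simp [commPart, ad_apply, mul_comm]

end Examples

end Literature.MathematicalPhysics.QuantumFieldTheory.Balaban1983to89.B9Eq352DivForm
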